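import Summits.PneNP.PneNP.Theorems.ChebyshevTracialDesignGammaDirectionFirstMoment
import Summits.PneNP.PneNP.Theorems.ChebyshevTracialDesignGammaDirectionLeibnizBounds
import HarnessLib

/-!
# Cell pnp-psdrank, route `ChebyshevTracialDesign`: brick 130's THIRD input (iii) — the centred first-moment profile of the
# γ-direction is relatively level-smooth with an explicit `ε_B` (crux `TracialDecayExp20`, stmt-PneNP-19878)

Brick 137 (eng g26; prover MEMO-30 §3 «(iii) is brick 133 + Lq + (V)», MEMO-29 §3, brick 133's READING). Brick 130 (`gammaProfile_newton_eval_zero_ge_of_centred`)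
asks on a window for three relative level-smoothness inequalities in the centred basis: `(hA)` for `A^m_c(x) = E_c[1_{X=x}(n_A − m)²]` (prover + eng bricks
135/136), `(hBm)` for the centred FIRST moment `B^m_c(x) = E_c[1_{X=x}(n_A − m)]` with right side `ε_B·√(A^m_1(x)·law_1(x))`, and `(hC)` for the law. This
file DISCHARGES `(hBm)` at a point (and packages `(hC)` with an explicit `ε_C`), with no new combinatorics:
* §1 `sum_le_of_termwise_of_budgets`: brick 133's termwise bound `|Δ^kB| ≤ P|Δ^kL′| + νk(|Δ^{k−1}L′| + |Δ^kL′|) + μ|Δ^kL|` summed against per-order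
  budgets `c_i|Δ^iL(0)| ≤ R₀(i)`, `c_i|Δ^iL′(0)| ≤ R₁(i)` (`c_k ≤ c_{k−1}`, brick 135's `centralCoeff_antitone`);
* §2 real arithmetic: geometric sums (`Σ_{k≤D} q^k ≤ 2q`, `Σ q^{k−1} ≤ 2` for `q ≤ ½`; `Σ(4/3)^k ≤ D(4/3)^D`), the closed form
  `Γ₁G₁(2Pq₁ + 3νD) + 2μΓ₀q₀G₀ + D(4/3)^D((P+2νD)T₁ + μT₀)`, and `le_eps_mul_sqrt_of_centred`: the CENTRING relation `P·G₁ = μ·G₀`, a window floor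
  `0 < LB ≤ G₀` and the variance floor `cV·G₀ ≤ A` turn it into `(E/√cV)·√(A·G₀)`;
* §3 **`sum_abs_fwdDiff_centredFirst_le_of_budgets`** — `(hBm)` LITERALLY (cut `2s+1`, `mf x = m`, point `x = x₁+2`), from budgets of the two law
  families in Lq's output shape (`[n]`: the tree's `abs_fwdDiff_iter_shellLaw_le_of_hyps`; one-pinned: brick 136 `levelBudget_pin1`), the centring
  hypothesis of brick 130 (read through brick 131 `centredFirst_eq_laws` at level `1`: `(2s/n)·Σ_v law_{[n]∖e_v}(2s₁+1,1;x₁) = m·law_{[n]}(2s+1,1;x)`, whence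
  `0 ≤ m`), the floor and (V) as hypotheses:
  `ε_B = (m(Γ₁(2q₁ + 3D/s) + 2Γ₀q₀) + D(4/3)^D((2s/n + 4D/n)·aT₁ + mT₀)/LB)/√cV`;
* §4 **`sum_abs_fwdDiff_shellLaw_le_of_budget`** — `(hC)` with `ε_C = 2Γ₀q₀ + D(4/3)^DT₀/LB` (the tree's `relSmooth_of_hyps` only gives `ε_C = 1`,
  useless next to `ε_B > 0` in brick 130's `ε_C + ε_B ≤ 1`).
The TURNKEY form (Lq and brick 136 plugged in, windows and margins merged, `m ≤ a`) is the companion file `…GammaDirectionFirstMomentTurnkey`.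
READING (brick 133): `m ≤ a ≤ N`, `Γq ≍ √D·D/N` (β-constants aside), `cV ≍ N` ⇒ `ε_B ≍ D^{3/2}/√N → 0`, `ε_C ≍ D^{3/2}/N → 0` for `D = dq n ≍ n^{1/4}`;
merging the constants / `n ≥ n₀` is the assembly's numerics (126b pattern). WHAT THIS FILE DOES NOT DO: prove (V), the window floor, `(hA)`, the numerics,
or anything on `TracialDecayExp20` itself, psd rank of P_PM(K_n), or P vs NP. [cite: Boole2009, Ch. II Art. 10 Ex. 3 eq. (8) (PDF pp. 34–35)]
[cite: Agarwal2000DifferenceEquations, Thm. 1.8.5 (1.8.6)] [cite: RollinRoss2010, §4.1 Thm 4.2] [cite: Rothvoss2017, §2 (PDF p. 6)]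
Stature: support/instrument (kernel lane, no defs, axioms standard). Supports stmt-PneNP-19878.
-/

set_option linter.dupNamespace false -- `Summit.PneNP.PneNP.…`: summit = sub-problem (D-0017)

noncomputable section

namespace Summit.PneNP.PneNP.Theorems.ChebyshevTracialDesignGammaDirectionFirstMomentBudget

open Finset Literature.Barriers.PneNP Literature.Combinatorics.Optimization
open Literature.Combinatorics.Optimization.ShellStep
open Summit.PneNP.PneNP.Theorems.ChebyshevTracialDesignGammaDirectionLeibnizBounds (centralCoeff_antitone)
open Summit.PneNP.PneNP.Theorems.ChebyshevTracialDesignGammaDirectionFirstMoment (abs_fwdDiff_iter_centredFirst_le)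
open Summit.PneNP.PneNP.Theorems.ChebyshevTracialDesignGammaDirectionCentredMoments (centredFirst_eq_laws)
open Summit.PneNP.PneNP.Theorems.ChebyshevTracialDesignVirtualPositivityCriterion (shellLaw_nonneg')

variable {n : ℕ}

/-! ### §1 From the termwise bound (brick 133) and per-order budgets to the weighted sum -/

/-- **Summation of brick 133's termwise bound against per-order budgets.** If for `1 ≤ k ≤ D`
`|Δ^kB(0)| ≤ P|Δ^kL′(0)| + νk(|Δ^{k−1}L′(0)| + |Δ^kL′(0)|) + μ|Δ^kL(0)|` (`P, ν, μ ≥ 0`) and the two law profiles carry per-order budgets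
`c_i|Δ^iL(0)| ≤ R₀(i)`, `c_i|Δ^iL′(0)| ≤ R₁(i)` for `i ≤ D` (`c_i = C(2i,i)/4^i`; at `i = 0` this reads `|L′(0)| ≤ R₁(0)`), then
`Σ_{k=1}^{D} c_k|Δ^kB(0)| ≤ Σ_{k=1}^{D} (P·R₁(k) + νk·(R₁(k−1) + R₁(k)) + μ·R₀(k))` (`c_k ≤ c_{k−1}` moves the weight onto the lower order).
[cite: Agarwal2000DifferenceEquations, Thm. 1.8.5 (1.8.6)] [cite: Boole2009, Ch. II Art. 10 Ex. 3 eq. (8) (PDF pp. 34–35)] -/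
theorem sum_le_of_termwise_of_budgets (B L L' : ℕ → ℝ) {P ν μ : ℝ} (hP : 0 ≤ P) (hν : 0 ≤ ν) (hμ : 0 ≤ μ) (D : ℕ)
    (hB : ∀ k ∈ Ico 1 (D + 1), |(fwdDiff (1 : ℕ))^[k] B 0| ≤
      P * |(fwdDiff (1 : ℕ))^[k] L' 0| + ν * (k : ℝ) * (|(fwdDiff (1 : ℕ))^[k - 1] L' 0| + |(fwdDiff (1 : ℕ))^[k] L' 0|) +
        μ * |(fwdDiff (1 : ℕ))^[k] L 0|)
    (R₀ R₁ : ℕ → ℝ)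
    (hR₀ : ∀ i, i ≤ D → (((2 * i).choose i : ℕ) : ℝ) / (4 : ℝ) ^ i * |(fwdDiff (1 : ℕ))^[i] L 0| ≤ R₀ i)
    (hR₁ : ∀ i, i ≤ D → (((2 * i).choose i : ℕ) : ℝ) / (4 : ℝ) ^ i * |(fwdDiff (1 : ℕ))^[i] L' 0| ≤ R₁ i) :
    ∑ k ∈ Ico 1 (D + 1), (((2 * k).choose k : ℕ) : ℝ) / (4 : ℝ) ^ k * |(fwdDiff (1 : ℕ))^[k] B 0| ≤
      ∑ k ∈ Ico 1 (D + 1), (P * R₁ k + ν * (k : ℝ) * (R₁ (k - 1) + R₁ k) + μ * R₀ k) := by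
  refine sum_le_sum fun k hk => ?_
  rw [mem_Ico] at hk
  obtain ⟨hk1, hkD⟩ := hk
  have hkD' : k ≤ D := Nat.lt_succ_iff.1 hkD
  set ck := (((2 * k).choose k : ℕ) : ℝ) / (4 : ℝ) ^ k with hck
  have hck0 : 0 ≤ ck := by positivity
  have hb := mul_le_mul_of_nonneg_left (hB k (mem_Ico.2 ⟨hk1, hkD⟩)) hck0
  set u₁₀ := |(fwdDiff (1 : ℕ))^[k] L' 0|
  set u₁₁ := |(fwdDiff (1 : ℕ))^[k - 1] L' 0|
  set u₀₀ := |(fwdDiff (1 : ℕ))^[k] L 0|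
  have hdist : ck * (P * u₁₀ + ν * (k : ℝ) * (u₁₁ + u₁₀) + μ * u₀₀) =
      P * (ck * u₁₀) + ν * (k : ℝ) * (ck * u₁₁ + ck * u₁₀) + μ * (ck * u₀₀) := by ring
  rw [hdist] at hb
  have hc1 : ck ≤ (((2 * (k - 1)).choose (k - 1) : ℕ) : ℝ) / (4 : ℝ) ^ (k - 1) := centralCoeff_antitone (by omega)
  have b₁₀ : ck * u₁₀ ≤ R₁ k := hR₁ k hkD'
  have b₁₁ : ck * u₁₁ ≤ R₁ (k - 1) := (mul_le_mul_of_nonneg_right hc1 (abs_nonneg _)).trans (hR₁ (k - 1) (by omega))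
  have b₀₀ : ck * u₀₀ ≤ R₀ k := hR₀ k hkD'
  have hνk : 0 ≤ ν * (k : ℝ) := by positivity
  have m₁ := mul_le_mul_of_nonneg_left b₁₀ hP
  have m₂ := mul_le_mul_of_nonneg_left (add_le_add b₁₁ b₁₀) hνk
  have m₃ := mul_le_mul_of_nonneg_left b₀₀ hμ
  linarith

/-! ### §2 Geometric budgets, the centring substitution, the window floor and the variance floor (real arithmetic) -/

/-- `Σ_{k ∈ [1, D]} q^k ≤ 2q` for `0 ≤ q ≤ 1/2`. [cite: Agarwal2000DifferenceEquations, Thm. 1.8.5 (1.8.6)] -/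
theorem sum_Ico_pow_le {q : ℝ} (hq0 : 0 ≤ q) (hq : q ≤ 1 / 2) (D : ℕ) : ∑ k ∈ Ico 1 (D + 1), q ^ k ≤ 2 * q := by
  have h := geom_sum_Ico_le_of_lt_one hq0 (by linarith) (m := 1) (n := D + 1)
  rw [pow_one] at h
  exact h.trans (by rw [div_le_iff₀ (by linarith)]; nlinarith)

/-- `Σ_{k ∈ [1, D]} q^{k−1} ≤ 2` for `0 ≤ q ≤ 1/2`. [cite: Agarwal2000DifferenceEquations, Thm. 1.8.5 (1.8.6)] -/
theorem sum_Ico_pow_pred_le {q : ℝ} (hq0 : 0 ≤ q) (hq : q ≤ 1 / 2) (D : ℕ) : ∑ k ∈ Ico 1 (D + 1), q ^ (k - 1) ≤ 2 := by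
  rw [sum_Ico_eq_sum_range]
  have e : ∑ k ∈ range (D + 1 - 1), q ^ (1 + k - 1) = ∑ k ∈ Ico 0 D, q ^ k := by
    rw [range_eq_Ico, show D + 1 - 1 = D from rfl]
    exact sum_congr rfl fun k _ => by rw [show 1 + k - 1 = k by omega]
  rw [e]
  have h := geom_sum_Ico_le_of_lt_one hq0 (by linarith) (m := 0) (n := D)
  rw [pow_zero] at h
  exact h.trans (by rw [div_le_iff₀ (by linarith)]; linarith)

/-- `Σ_{k ∈ [1, D]} r^k ≤ D·r^D` and `Σ_{k ∈ [1,D]} r^{k−1} ≤ D·r^D` for `1 ≤ r`. [cite: Agarwal2000DifferenceEquations, Thm. 1.8.5 (1.8.6)] -/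
theorem sum_Ico_pow_le_card_mul {r : ℝ} (hr : 1 ≤ r) (D : ℕ) :
    ∑ k ∈ Ico 1 (D + 1), r ^ k ≤ (D : ℝ) * r ^ D ∧ ∑ k ∈ Ico 1 (D + 1), r ^ (k - 1) ≤ (D : ℝ) * r ^ D := by
  have hcard : ((Ico 1 (D + 1)).card : ℝ) = D := by rw [Nat.card_Ico]; push_cast; ring
  have h₁ := sum_le_card_nsmul (Ico 1 (D + 1)) (fun k => r ^ k) (r ^ D) fun k hk => by
    rw [mem_Ico] at hk; exact pow_le_pow_right₀ hr (by omega)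
  have h₂ := sum_le_card_nsmul (Ico 1 (D + 1)) (fun k => r ^ (k - 1)) (r ^ D) fun k hk => by
    rw [mem_Ico] at hk; exact pow_le_pow_right₀ hr (by omega)
  rw [nsmul_eq_mul, hcard] at h₁ h₂; exact ⟨h₁, h₂⟩

/-- **The budget sum in closed form.** With geometric budgets `R₁(k) = Γ₁q₁^kG₁ + T₁(4/3)^k`, `R₀(k) = Γ₀q₀^kG₀ + T₀(4/3)^k`
(all parameters `≥ 0`, `q₀, q₁ ≤ 1/2`; written `(4/3)^k·T`), the right side of `sum_le_of_termwise_of_budgets` is at most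
`Γ₁G₁·(2Pq₁ + 3νD) + 2μΓ₀q₀G₀ + D(4/3)^D·((P + 2νD)T₁ + μT₀)` (`k ≤ D`, `Σq^k ≤ 2q`, `Σq^{k−1} ≤ 2`, `Σ(4/3)^k, Σ(4/3)^{k−1} ≤ D(4/3)^D`).
[cite: Agarwal2000DifferenceEquations, Thm. 1.8.5 (1.8.6)] -/
theorem sum_geometric_budgets_le (D : ℕ) {P ν μ Γ₀ q₀ T₀ G₀ Γ₁ q₁ T₁ G₁ : ℝ} (hP : 0 ≤ P) (hν : 0 ≤ ν) (hμ : 0 ≤ μ)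
    (hΓ₀ : 0 ≤ Γ₀) (hq₀ : 0 ≤ q₀) (hq₀' : q₀ ≤ 1 / 2) (hT₀ : 0 ≤ T₀) (hG₀ : 0 ≤ G₀)
    (hΓ₁ : 0 ≤ Γ₁) (hq₁ : 0 ≤ q₁) (hq₁' : q₁ ≤ 1 / 2) (hT₁ : 0 ≤ T₁) (hG₁ : 0 ≤ G₁) :
    ∑ k ∈ Ico 1 (D + 1), (P * (Γ₁ * q₁ ^ k * G₁ + (4 / 3 : ℝ) ^ k * T₁) +
        ν * (k : ℝ) * ((Γ₁ * q₁ ^ (k - 1) * G₁ + (4 / 3 : ℝ) ^ (k - 1) * T₁) + (Γ₁ * q₁ ^ k * G₁ + (4 / 3 : ℝ) ^ k * T₁)) +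
        μ * (Γ₀ * q₀ ^ k * G₀ + (4 / 3 : ℝ) ^ k * T₀)) ≤
      Γ₁ * G₁ * (2 * P * q₁ + 3 * ν * D) + 2 * μ * Γ₀ * q₀ * G₀ +
        (D : ℝ) * (4 / 3 : ℝ) ^ D * ((P + 2 * ν * D) * T₁ + μ * T₀) := by
  -- bound `k ≤ D` in the middle group, then sum the geometric pieces
  have hstep : ∀ k ∈ Ico 1 (D + 1),
      P * (Γ₁ * q₁ ^ k * G₁ + (4 / 3 : ℝ) ^ k * T₁) +
        ν * (k : ℝ) * ((Γ₁ * q₁ ^ (k - 1) * G₁ + (4 / 3 : ℝ) ^ (k - 1) * T₁) + (Γ₁ * q₁ ^ k * G₁ + (4 / 3 : ℝ) ^ k * T₁)) +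
        μ * (Γ₀ * q₀ ^ k * G₀ + (4 / 3 : ℝ) ^ k * T₀) ≤
      (P * Γ₁ * G₁) * q₁ ^ k + (P * T₁) * (4 / 3 : ℝ) ^ k +
        (ν * D * Γ₁ * G₁) * q₁ ^ (k - 1) + (ν * D * Γ₁ * G₁) * q₁ ^ k +
        (ν * D * T₁) * (4 / 3 : ℝ) ^ (k - 1) + (ν * D * T₁) * (4 / 3 : ℝ) ^ k +
        (μ * Γ₀ * G₀) * q₀ ^ k + (μ * T₀) * (4 / 3 : ℝ) ^ k := by
    intro k hk
    rw [mem_Ico] at hk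
    have hkD : (k : ℝ) ≤ D := by exact_mod_cast Nat.lt_succ_iff.1 hk.2
    have hin : 0 ≤ (Γ₁ * q₁ ^ (k - 1) * G₁ + (4 / 3 : ℝ) ^ (k - 1) * T₁) + (Γ₁ * q₁ ^ k * G₁ + (4 / 3 : ℝ) ^ k * T₁) := by
      positivity
    have hm : ν * (k : ℝ) * ((Γ₁ * q₁ ^ (k - 1) * G₁ + (4 / 3 : ℝ) ^ (k - 1) * T₁) + (Γ₁ * q₁ ^ k * G₁ + (4 / 3 : ℝ) ^ k * T₁)) ≤
        ν * (D : ℝ) * ((Γ₁ * q₁ ^ (k - 1) * G₁ + (4 / 3 : ℝ) ^ (k - 1) * T₁) + (Γ₁ * q₁ ^ k * G₁ + (4 / 3 : ℝ) ^ k * T₁)) :=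
      mul_le_mul_of_nonneg_right (mul_le_mul_of_nonneg_left hkD hν) hin
    linarith
  refine (sum_le_sum hstep).trans ?_
  simp only [sum_add_distrib, ← mul_sum]
  have s₁ := sum_Ico_pow_le hq₁ hq₁' D
  have s₁' := sum_Ico_pow_pred_le hq₁ hq₁' D
  have s₀ := sum_Ico_pow_le hq₀ hq₀' D
  obtain ⟨s₄, s₄'⟩ := sum_Ico_pow_le_card_mul (by norm_num : (1 : ℝ) ≤ 4 / 3) D
  have m₁ := mul_le_mul_of_nonneg_left s₁ (by positivity : 0 ≤ P * Γ₁ * G₁)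
  have m₂ := mul_le_mul_of_nonneg_left s₄ (by positivity : 0 ≤ P * T₁)
  have m₃ := mul_le_mul_of_nonneg_left s₁' (by positivity : 0 ≤ ν * D * Γ₁ * G₁)
  have m₄ := mul_le_mul_of_nonneg_left s₁ (by positivity : 0 ≤ ν * D * Γ₁ * G₁)
  have m₅ := mul_le_mul_of_nonneg_left s₄' (by positivity : 0 ≤ ν * D * T₁)
  have m₆ := mul_le_mul_of_nonneg_left s₄ (by positivity : 0 ≤ ν * D * T₁)
  have m₇ := mul_le_mul_of_nonneg_left s₀ (by positivity : 0 ≤ μ * Γ₀ * G₀)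
  have m₈ := mul_le_mul_of_nonneg_left s₄ (by positivity : 0 ≤ μ * T₀)
  have hq₁1 : q₁ ≤ 1 := by linarith
  have e : ν * ↑D * Γ₁ * G₁ * (2 * q₁) ≤ ν * ↑D * Γ₁ * G₁ * 1 :=
    mul_le_mul_of_nonneg_left (by linarith) (by positivity)
  nlinarith [m₁, m₂, m₃, m₄, m₅, m₆, m₇, m₈, e]

/-- **Centring, window floor and variance floor.** If `X ≤ Γ₁G₁(2Pq₁ + 3νD) + 2μΓ₀q₀G₀ + D(4/3)^D((P + 2νD)T₁ + μT₀)`, `P·G₁ = μ·G₀` (`P > 0`),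
`0 < LB ≤ G₀` and `cV·G₀ ≤ A` (`cV > 0`), then `X ≤ (E/√cV)·√(A·G₀)` for every `E ≥ μ(Γ₁(2q₁ + 3νD/P) + 2Γ₀q₀) + D(4/3)^D((P + 2νD)T₁ + μT₀)/LB`.
[cite: Agarwal2000DifferenceEquations, Thm. 1.8.5 (1.8.6)] -/
theorem le_eps_mul_sqrt_of_centred {X P ν μ Γ₀ q₀ T₀ G₀ Γ₁ q₁ T₁ G₁ LB cV A : ℝ} (D : ℕ)
    (hX : X ≤ Γ₁ * G₁ * (2 * P * q₁ + 3 * ν * D) + 2 * μ * Γ₀ * q₀ * G₀ +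
        (D : ℝ) * (4 / 3 : ℝ) ^ D * ((P + 2 * ν * D) * T₁ + μ * T₀))
    (hP : 0 < P) (hν : 0 ≤ ν) (hμ : 0 ≤ μ) (hΓ₀ : 0 ≤ Γ₀) (hq₀ : 0 ≤ q₀) (hT₀ : 0 ≤ T₀)
    (hΓ₁ : 0 ≤ Γ₁) (hq₁ : 0 ≤ q₁) (hT₁ : 0 ≤ T₁)
    (hcen : P * G₁ = μ * G₀) (hLB0 : 0 < LB) (hLB : LB ≤ G₀) (hcV : 0 < cV) (hV : cV * G₀ ≤ A) {E : ℝ}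
    (hE : μ * (Γ₁ * (2 * q₁ + 3 * ν * D / P) + 2 * Γ₀ * q₀) +
        (D : ℝ) * (4 / 3 : ℝ) ^ D * ((P + 2 * ν * D) * T₁ + μ * T₀) / LB ≤ E) :
    X ≤ E / Real.sqrt cV * Real.sqrt (A * G₀) := by
  have hG₀ : 0 < G₀ := lt_of_lt_of_le hLB0 hLB
  -- centring: `G₁ = μ G₀ / P`
  have hG₁ : G₁ = μ * G₀ / P := by rw [eq_div_iff hP.ne', mul_comm, hcen]
  -- the tail over the floor
  set Tail := (D : ℝ) * (4 / 3 : ℝ) ^ D * ((P + 2 * ν * D) * T₁ + μ * T₀) with hTail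
  have hTail0 : 0 ≤ Tail := by positivity
  have hTail : Tail ≤ Tail / LB * G₀ := by
    rw [div_mul_eq_mul_div, le_div_iff₀ hLB0]
    exact mul_le_mul_of_nonneg_left hLB hTail0
  -- the main terms in units of `G₀`
  have hmain : Γ₁ * G₁ * (2 * P * q₁ + 3 * ν * D) = μ * (Γ₁ * (2 * q₁ + 3 * ν * D / P)) * G₀ := by
    rw [hG₁]; field_simp
  set E' := μ * (Γ₁ * (2 * q₁ + 3 * ν * D / P) + 2 * Γ₀ * q₀) + Tail / LB with hE'
  have hE'0 : 0 ≤ E' := by positivity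
  have hE0 : 0 ≤ E := hE'0.trans hE
  have hXE : X ≤ E * G₀ := by
    have : E' * G₀ = μ * (Γ₁ * (2 * q₁ + 3 * ν * D / P)) * G₀ + 2 * μ * Γ₀ * q₀ * G₀ + Tail / LB * G₀ := by rw [hE']; ring
    have hXE' : X ≤ E' * G₀ := by rw [this, ← hmain]; linarith
    exact hXE'.trans (mul_le_mul_of_nonneg_right hE hG₀.le)
  -- the variance floor: `G₀ ≤ √(A G₀)/√cV`
  have hsq : G₀ ≤ Real.sqrt (A * G₀) / Real.sqrt cV := by
    rw [le_div_iff₀ (Real.sqrt_pos.2 hcV)]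
    have h1 : G₀ * Real.sqrt cV = Real.sqrt (G₀ * G₀ * cV) := by
      rw [Real.sqrt_mul (mul_self_nonneg _), Real.sqrt_mul_self hG₀.le]
    rw [h1]
    exact Real.sqrt_le_sqrt (by nlinarith)
  calc X ≤ E * G₀ := hXE
    _ ≤ E * (Real.sqrt (A * G₀) / Real.sqrt cV) := mul_le_mul_of_nonneg_left hsq hE0
    _ = E / Real.sqrt cV * Real.sqrt (A * G₀) := by ring


/-- **The abstract assembly.** Termwise bound (brick 133's shape) + geometric per-order budgets of the two law profiles in Lq's shape
(`1 ≤ k ≤ D`; `Γ₀, Γ₁ ≥ 1` take care of the order `0`, where the budget must dominate `L′(0) = G₁ ≥ 0`) ⇒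
`Σ_{k=1}^{D} c_k|Δ^kB(0)| ≤ Γ₁G₁(2Pq₁ + 3νD) + 2μΓ₀q₀G₀ + D(4/3)^D((P + 2νD)T₁ + μT₀)`.
[cite: Agarwal2000DifferenceEquations, Thm. 1.8.5 (1.8.6)] [cite: Boole2009, Ch. II Art. 10 Ex. 3 eq. (8) (PDF pp. 34–35)] -/
theorem sum_le_closed_of_termwise_of_geometric (B L L' : ℕ → ℝ) (D : ℕ) {P ν μ Γ₀ q₀ T₀ G₀ Γ₁ q₁ T₁ G₁ : ℝ}
    (hP : 0 ≤ P) (hν : 0 ≤ ν) (hμ : 0 ≤ μ)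
    (hΓ₀ : 1 ≤ Γ₀) (hq₀ : 0 ≤ q₀) (hq₀' : q₀ ≤ 1 / 2) (hT₀ : 0 ≤ T₀)
    (hΓ₁ : 1 ≤ Γ₁) (hq₁ : 0 ≤ q₁) (hq₁' : q₁ ≤ 1 / 2) (hT₁ : 0 ≤ T₁)
    (hLG : L 0 = G₀) (hG₀ : 0 ≤ G₀) (hL'G : L' 0 = G₁) (hG₁ : 0 ≤ G₁)
    (hB : ∀ k ∈ Ico 1 (D + 1), |(fwdDiff (1 : ℕ))^[k] B 0| ≤
      P * |(fwdDiff (1 : ℕ))^[k] L' 0| + ν * (k : ℝ) * (|(fwdDiff (1 : ℕ))^[k - 1] L' 0| + |(fwdDiff (1 : ℕ))^[k] L' 0|) +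
        μ * |(fwdDiff (1 : ℕ))^[k] L 0|)
    (hR₀ : ∀ k ∈ Ico 1 (D + 1), (((2 * k).choose k : ℕ) : ℝ) / (4 : ℝ) ^ k * |(fwdDiff (1 : ℕ))^[k] L 0| ≤
      Γ₀ * q₀ ^ k * G₀ + (4 / 3 : ℝ) ^ k * T₀)
    (hR₁ : ∀ k ∈ Ico 1 (D + 1), (((2 * k).choose k : ℕ) : ℝ) / (4 : ℝ) ^ k * |(fwdDiff (1 : ℕ))^[k] L' 0| ≤
      Γ₁ * q₁ ^ k * G₁ + (4 / 3 : ℝ) ^ k * T₁) :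
    ∑ k ∈ Ico 1 (D + 1), (((2 * k).choose k : ℕ) : ℝ) / (4 : ℝ) ^ k * |(fwdDiff (1 : ℕ))^[k] B 0| ≤
      Γ₁ * G₁ * (2 * P * q₁ + 3 * ν * D) + 2 * μ * Γ₀ * q₀ * G₀ +
        (D : ℝ) * (4 / 3 : ℝ) ^ D * ((P + 2 * ν * D) * T₁ + μ * T₀) := by
  have h1 := sum_le_of_termwise_of_budgets B L L' hP hν hμ D hB
    (fun i => Γ₀ * q₀ ^ i * G₀ + (4 / 3 : ℝ) ^ i * T₀) (fun i => Γ₁ * q₁ ^ i * G₁ + (4 / 3 : ℝ) ^ i * T₁)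
    (fun i hi => by
      rcases Nat.eq_zero_or_pos i with h0 | h0
      · subst h0
        simp only [Nat.mul_zero, Nat.choose_zero_right, Nat.cast_one, pow_zero, div_one, one_mul, mul_one,
          Function.iterate_zero, id_eq, hLG, abs_of_nonneg hG₀]
        nlinarith
      · exact hR₀ i (mem_Ico.2 ⟨h0, Nat.lt_succ_of_le hi⟩))
    (fun i hi => by
      rcases Nat.eq_zero_or_pos i with h0 | h0
      · subst h0
        simp only [Nat.mul_zero, Nat.choose_zero_right, Nat.cast_one, pow_zero, div_one, one_mul, mul_one,
          Function.iterate_zero, id_eq, hL'G, abs_of_nonneg hG₁]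
        nlinarith
      · exact hR₁ i (mem_Ico.2 ⟨h0, Nat.lt_succ_of_le hi⟩))
  exact h1.trans (sum_geometric_budgets_le D hP hν hμ (zero_le_one.trans hΓ₀) hq₀ hq₀' hT₀ hG₀
    (zero_le_one.trans hΓ₁) hq₁ hq₁' hT₁ hG₁)

/-! ### §3 The shell instance: hypothesis `(hBm)` of brick 130 at a point, from per-order budgets of the two law families -/

/-- **Brick 130's third input (iii), from budgets.** For a perfect matching `M` (partner map `π`), a block `H` with `a = |reps(vAA)|` `HH` edges,
an odd cut `2s+1 = (2s₁+1) + 2`, an order `D ≤ s` with `2s + 2D + 2 ≤ n`, a point `x = x₁ + 2`, and a centring `m` with `B^m_1(x) = 0`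
(brick 130's `hcentre`), suppose the two plain law families of brick 133 carry geometric per-order budgets in Lq's shape (`1 ≤ k ≤ D`):
`c_k|Δ^k_j law_{[n]}(2s+1,2j+1;x)(0)| ≤ Γ₀q₀^k·law_{[n]}(2s+1,1;x) + (4/3)^k T₀` (the tree's `abs_fwdDiff_iter_shellLaw_le_of_hyps`, `T₀` its far term)
and `c_k|Δ^k_j Σ_v law_{[n]∖e_v}(2s₁+1,2j+1;x₁)(0)| ≤ Γ₁q₁^k·Σ_v law_{[n]∖e_v}(2s₁+1,1;x₁) + a·((4/3)^k T₁)` (brick 136 `levelBudget_pin1`),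
with `Γ₀, Γ₁ ≥ 1`, `0 ≤ q₀, q₁ ≤ ½`, `T₀, T₁ ≥ 0`; a window floor `0 < LB ≤ law_{[n]}(2s+1,1;x)`; and the variance floor (V)
`cV·law_{[n]}(2s+1,1;x) ≤ A^m_1(x)`, `cV > 0` (lit `centredSq_section_ge_of_brackets`, supplied by the assembly). Then, LITERALLY in the currency of
hypothesis `(hBm)` of `gammaProfile_newton_eval_zero_ge_of_centred` (cut `t = 2s+1`, `mf x = m`),
`Σ_{k=1}^{D} c_k|Δ^k_j B^m_{2j+1}(x)(0)| ≤ ε_B·√(A^m_1(x)·law_{[n]}(2s+1,1;x))`,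
`ε_B = (m·(Γ₁(2q₁ + 3D/s) + 2Γ₀q₀) + D(4/3)^D((2s/n + 4D/n)·aT₁ + mT₀)/LB)/√cV` — brick 133 termwise with `c_k ≤ c_{k−1}`, the centring
`(2s/n)·Σ_v law_{[n]∖e_v}(2s₁+1,1;x₁) = m·law_{[n]}(2s+1,1;x)` (brick 131 at level `1`; it also gives `0 ≤ m`), far terms over the floor, `law ≤ √(A·law/cV)`.
READING (MEMO-29 §3, brick 133): `m ≤ a ≍ N`, `Γq ≍ D^{3/2}/N`, `cV ≍ N` ⇒ `ε_B ≍ D^{3/2}/√N → 0` for `D = dq n`; merging the constants is the assembly's numerics.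
[cite: Boole2009, Ch. II Art. 10 Ex. 3 eq. (8) (PDF pp. 34–35)] [cite: Agarwal2000DifferenceEquations, Thm. 1.8.5 (1.8.6)] [cite: Rothvoss2017, §2 (PDF p. 6)] -/
theorem sum_abs_fwdDiff_centredFirst_le_of_budgets (M : PMatch n) (H : Finset (Fin n)) {s s₁ D x x₁ : ℕ} (hs₁ : s₁ + 1 = s)
    (hx₁ : x₁ + 2 = x) (hDs : D ≤ s) (hsn : 2 * s + 2 * D + 2 ≤ n) (m : ℝ)
    {Γ₀ q₀ T₀ Γ₁ q₁ T₁ LB cV : ℝ} (hΓ₀ : 1 ≤ Γ₀) (hq₀ : 0 ≤ q₀) (hq₀' : q₀ ≤ 1 / 2) (hT₀ : 0 ≤ T₀)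
    (hΓ₁ : 1 ≤ Γ₁) (hq₁ : 0 ≤ q₁) (hq₁' : q₁ ≤ 1 / 2) (hT₁ : 0 ≤ T₁)
    (hR₀ : ∀ k ∈ Ico 1 (D + 1), (((2 * k).choose k : ℕ) : ℝ) / (4 : ℝ) ^ k *
        |(fwdDiff (1 : ℕ))^[k] (fun j => shellLaw M.2.partner univ H (2 * s + 1) (2 * j + 1) x) 0| ≤
      Γ₀ * q₀ ^ k * shellLaw M.2.partner univ H (2 * s + 1) 1 x + (4 / 3 : ℝ) ^ k * T₀)
    (hR₁ : ∀ k ∈ Ico 1 (D + 1), (((2 * k).choose k : ℕ) : ℝ) / (4 : ℝ) ^ k *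
        |(fwdDiff (1 : ℕ))^[k] (fun j => ∑ v ∈ reps M.2.partner (vAA M.2.partner univ H),
            shellLaw M.2.partner (univ \ {v, M.2.partner v}) H (2 * s₁ + 1) (2 * j + 1) x₁) 0| ≤
      Γ₁ * q₁ ^ k * (∑ v ∈ reps M.2.partner (vAA M.2.partner univ H), shellLaw M.2.partner (univ \ {v, M.2.partner v}) H (2 * s₁ + 1) 1 x₁) +
        (reps M.2.partner (vAA M.2.partner univ H)).card * ((4 / 3 : ℝ) ^ k * T₁))
    (hcentre : ((∑ U ∈ ((shell M.2.partner (2 * s + 1) 1).filter fun U => ((U ∩ H).card : ℤ) = x),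
          (((((reps M.2.partner (vAA M.2.partner univ H)).filter fun v => v ∈ U ∧ M.2.partner v ∈ U).card : ℕ) : ℝ) - m)) /
          ((shell M.2.partner (2 * s + 1) 1).card : ℝ)) = 0)
    (hLB0 : 0 < LB) (hLB : LB ≤ shellLaw M.2.partner univ H (2 * s + 1) 1 x) (hcV : 0 < cV)
    (hV : cV * shellLaw M.2.partner univ H (2 * s + 1) 1 x ≤
      ((∑ U ∈ ((shell M.2.partner (2 * s + 1) 1).filter fun U => ((U ∩ H).card : ℤ) = x),
          (((((reps M.2.partner (vAA M.2.partner univ H)).filter fun v => v ∈ U ∧ M.2.partner v ∈ U).card : ℕ) : ℝ) - m) ^ 2) /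
          ((shell M.2.partner (2 * s + 1) 1).card : ℝ))) :
    ∑ k ∈ Ico 1 (D + 1), (((2 * k).choose k : ℕ) : ℝ) / (4 : ℝ) ^ k *
        |(fwdDiff (1 : ℕ))^[k] (fun j => ((∑ U ∈ ((shell M.2.partner (2 * s + 1) (2 * j + 1)).filter fun U => ((U ∩ H).card : ℤ) = x),
          (((((reps M.2.partner (vAA M.2.partner univ H)).filter fun v => v ∈ U ∧ M.2.partner v ∈ U).card : ℕ) : ℝ) - m)) /
          ((shell M.2.partner (2 * s + 1) (2 * j + 1)).card : ℝ))) 0| ≤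
      (m * (Γ₁ * (2 * q₁ + 3 * D / s) + 2 * Γ₀ * q₀) +
          (D : ℝ) * (4 / 3 : ℝ) ^ D * ((2 * (s : ℝ) / n + 4 * D / n) * ((reps M.2.partner (vAA M.2.partner univ H)).card * T₁) + m * T₀) / LB) /
        Real.sqrt cV *
      Real.sqrt (((∑ U ∈ ((shell M.2.partner (2 * s + 1) 1).filter fun U => ((U ∩ H).card : ℤ) = x),
          (((((reps M.2.partner (vAA M.2.partner univ H)).filter fun v => v ∈ U ∧ M.2.partner v ∈ U).card : ℕ) : ℝ) - m) ^ 2) /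
          ((shell M.2.partner (2 * s + 1) 1).card : ℝ)) * shellLaw M.2.partner univ H (2 * s + 1) 1 x) := by
  -- sizes and small facts
  have hn0 : (0 : ℝ) < n := by exact_mod_cast (show 0 < n by omega)
  have hs0 : (0 : ℝ) < s := by exact_mod_cast (show 0 < s by omega)
  have hodd : Odd (2 * s₁ + 1 + 2) := ⟨s₁ + 1, by ring⟩
  have ecut : 2 * s₁ + 1 + 2 = 2 * s + 1 := by omega
  have ex : (x : ℤ) - 2 = ((x₁ : ℕ) : ℤ) := by push_cast [← hx₁]; ring
  have ecoef : ((2 * s₁ + 1 : ℕ) : ℝ) + 1 = 2 * (s : ℝ) := by push_cast [← hs₁]; ring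
  have hG₀0 : 0 < shellLaw M.2.partner univ H (2 * s + 1) 1 x := lt_of_lt_of_le hLB0 hLB
  have hG₁0 : 0 ≤ ∑ v ∈ reps M.2.partner (vAA M.2.partner univ H),
      shellLaw M.2.partner (univ \ {v, M.2.partner v}) H (2 * s₁ + 1) 1 x₁ :=
    sum_nonneg fun v _ => shellLaw_nonneg' (π := M.2.partner) _ _ _ _ _
  have ha0 : (0 : ℝ) ≤ (reps M.2.partner (vAA M.2.partner univ H)).card := Nat.cast_nonneg _
  -- the centring in law form (brick 131 at level `1`): `(2s/n)·G₁ = m·G₀`, hence `0 ≤ m`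
  have hcen : 2 * (s : ℝ) / n * (∑ v ∈ reps M.2.partner (vAA M.2.partner univ H),
      shellLaw M.2.partner (univ \ {v, M.2.partner v}) H (2 * s₁ + 1) 1 x₁) = m * shellLaw M.2.partner univ H (2 * s + 1) 1 x := by
    have h := centredFirst_eq_laws M H (c := 1) hodd ⟨0, by ring⟩ (by omega) (by omega) (x : ℤ) m
    rw [ecut, ex] at h
    rw [h] at hcentre
    have e : (((2 * s₁ + 1 : ℕ) : ℝ) + 2 - ((1 : ℕ) : ℝ)) / (n : ℝ) = 2 * (s : ℝ) / n := by
      congr 1; push_cast [← hs₁]; ring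
    rw [e] at hcentre
    exact sub_eq_zero.1 hcentre
  have hm0 : 0 ≤ m := by
    have h2 : 0 ≤ m * shellLaw M.2.partner univ H (2 * s + 1) 1 x := by
      rw [← hcen]; exact mul_nonneg (by positivity) hG₁0
    by_contra hneg
    have h1 : m * shellLaw M.2.partner univ H (2 * s + 1) 1 x < 0 := mul_neg_of_neg_of_pos (not_le.mp hneg) hG₀0
    linarith
  -- brick 133, termwise, in the assembly's shape
  have hB : ∀ k ∈ Ico 1 (D + 1),
      |(fwdDiff (1 : ℕ))^[k] (fun j => ((∑ U ∈ ((shell M.2.partner (2 * s + 1) (2 * j + 1)).filter fun U => ((U ∩ H).card : ℤ) = x),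
          (((((reps M.2.partner (vAA M.2.partner univ H)).filter fun v => v ∈ U ∧ M.2.partner v ∈ U).card : ℕ) : ℝ) - m)) /
          ((shell M.2.partner (2 * s + 1) (2 * j + 1)).card : ℝ))) 0| ≤
      2 * (s : ℝ) / n * |(fwdDiff (1 : ℕ))^[k] (fun j => ∑ v ∈ reps M.2.partner (vAA M.2.partner univ H),
            shellLaw M.2.partner (univ \ {v, M.2.partner v}) H (2 * s₁ + 1) (2 * j + 1) x₁) 0| +
        2 / (n : ℝ) * (k : ℝ) *
          (|(fwdDiff (1 : ℕ))^[k - 1] (fun j => ∑ v ∈ reps M.2.partner (vAA M.2.partner univ H),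
              shellLaw M.2.partner (univ \ {v, M.2.partner v}) H (2 * s₁ + 1) (2 * j + 1) x₁) 0| +
            |(fwdDiff (1 : ℕ))^[k] (fun j => ∑ v ∈ reps M.2.partner (vAA M.2.partner univ H),
              shellLaw M.2.partner (univ \ {v, M.2.partner v}) H (2 * s₁ + 1) (2 * j + 1) x₁) 0|) +
        m * |(fwdDiff (1 : ℕ))^[k] (fun j => shellLaw M.2.partner univ H (2 * s + 1) (2 * j + 1) x) 0| := by
    intro k hk
    rw [mem_Ico] at hk
    have h := abs_fwdDiff_iter_centredFirst_le M H hodd (x : ℤ) m hk.1 (by omega) (by omega)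
    rw [ecut, ex, ecoef, abs_of_nonneg hm0] at h
    refine h.trans (le_of_eq ?_)
    ring
  -- budgets of the one-pinned family in the symmetric shape
  have hR₁' : ∀ k ∈ Ico 1 (D + 1), (((2 * k).choose k : ℕ) : ℝ) / (4 : ℝ) ^ k *
        |(fwdDiff (1 : ℕ))^[k] (fun j => ∑ v ∈ reps M.2.partner (vAA M.2.partner univ H),
            shellLaw M.2.partner (univ \ {v, M.2.partner v}) H (2 * s₁ + 1) (2 * j + 1) x₁) 0| ≤
      Γ₁ * q₁ ^ k * (∑ v ∈ reps M.2.partner (vAA M.2.partner univ H), shellLaw M.2.partner (univ \ {v, M.2.partner v}) H (2 * s₁ + 1) 1 x₁) +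
        (4 / 3 : ℝ) ^ k * ((reps M.2.partner (vAA M.2.partner univ H)).card * T₁) :=
    fun k hk => (hR₁ k hk).trans (le_of_eq (by ring))
  -- §2: the closed form
  have key := sum_le_closed_of_termwise_of_geometric _ _ _ D (P := 2 * (s : ℝ) / n) (ν := 2 / (n : ℝ)) (μ := m)
    (by positivity) (by positivity) hm0 hΓ₀ hq₀ hq₀' hT₀ hΓ₁ hq₁ hq₁' (by positivity : 0 ≤ _ * T₁)
    (by simp only [Nat.mul_zero, Nat.zero_add]) hG₀0.le (by simp only [Nat.mul_zero, Nat.zero_add]) hG₁0 hB hR₀ hR₁'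
  -- centring, floors
  refine le_eps_mul_sqrt_of_centred D key (by positivity) (by positivity) hm0 (zero_le_one.trans hΓ₀) hq₀ hT₀
    (zero_le_one.trans hΓ₁) hq₁ (by positivity) hcen hLB0 hLB hcV hV (le_of_eq ?_)
  field_simp
  ring




/-! ### §4 Brick 130's first input (i) with an explicit `ε_C` (the law's own budget summed over the floor) -/

/-- **Hypothesis `(hC)` of brick 130 with an explicit `ε_C`.** From a per-order budget in Lq's shape
`c_k|Δ^k_j law(2s+1,2j+1;x)(0)| ≤ Γ₀q₀^k·law(2s+1,1;x) + (4/3)^kT₀` (`1 ≤ k ≤ D`, `0 ≤ Γ₀`, `0 ≤ q₀ ≤ ½`, `0 ≤ T₀`) and a window floor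
`0 < LB ≤ law(2s+1,1;x)`: `Σ_{k=1}^{D} c_k|Δ^k_j law(2s+1,2j+1;x)(0)| ≤ (2Γ₀q₀ + D(4/3)^DT₀/LB)·law(2s+1,1;x)` — the shape of `(hC)` of
`gammaProfile_newton_eval_zero_ge_of_centred` with `ε_C = 2Γ₀q₀ + D(4/3)^DT₀/LB` (the tree's `relSmooth_of_hyps` is the case `ε_C = 1`, too weak next to
`ε_B > 0`). [cite: Agarwal2000DifferenceEquations, Thm. 1.8.5 (1.8.6)] [cite: RollinRoss2010, §4.1 Thm 4.2] -/
theorem sum_abs_fwdDiff_shellLaw_le_of_budget {π : Fin n → Fin n} (S H : Finset (Fin n)) {t D : ℕ} {x : ℤ}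
    {Γ₀ q₀ T₀ LB : ℝ} (hΓ₀ : 0 ≤ Γ₀) (hq₀ : 0 ≤ q₀) (hq₀' : q₀ ≤ 1 / 2) (hT₀ : 0 ≤ T₀)
    (hR₀ : ∀ k ∈ Ico 1 (D + 1), (((2 * k).choose k : ℕ) : ℝ) / (4 : ℝ) ^ k *
        |(fwdDiff (1 : ℕ))^[k] (fun j => shellLaw π S H t (2 * j + 1) x) 0| ≤
      Γ₀ * q₀ ^ k * shellLaw π S H t 1 x + (4 / 3 : ℝ) ^ k * T₀)
    (hLB0 : 0 < LB) (hLB : LB ≤ shellLaw π S H t 1 x) :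
    ∑ k ∈ Ico 1 (D + 1), (((2 * k).choose k : ℕ) : ℝ) / (4 : ℝ) ^ k *
        |(fwdDiff (1 : ℕ))^[k] (fun j => shellLaw π S H t (2 * j + 1) x) 0| ≤
      (2 * Γ₀ * q₀ + (D : ℝ) * (4 / 3 : ℝ) ^ D * T₀ / LB) * shellLaw π S H t 1 x := by
  have hG : 0 ≤ shellLaw π S H t 1 x := shellLaw_nonneg' (π := π) _ _ _ _ _
  have s₀ := sum_Ico_pow_le hq₀ hq₀' D
  obtain ⟨s₄, -⟩ := sum_Ico_pow_le_card_mul (by norm_num : (1 : ℝ) ≤ 4 / 3) D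
  have e : ∑ k ∈ Ico 1 (D + 1), (Γ₀ * q₀ ^ k * shellLaw π S H t 1 x + (4 / 3 : ℝ) ^ k * T₀) =
      Γ₀ * shellLaw π S H t 1 x * ∑ k ∈ Ico 1 (D + 1), q₀ ^ k + T₀ * ∑ k ∈ Ico 1 (D + 1), (4 / 3 : ℝ) ^ k := by
    rw [sum_add_distrib, mul_sum, mul_sum]
    congr 1 <;> exact sum_congr rfl fun k _ => by ring
  have m₁ : Γ₀ * shellLaw π S H t 1 x * ∑ k ∈ Ico 1 (D + 1), q₀ ^ k ≤ Γ₀ * shellLaw π S H t 1 x * (2 * q₀) :=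
    mul_le_mul_of_nonneg_left s₀ (mul_nonneg hΓ₀ hG)
  have m₂ : T₀ * ∑ k ∈ Ico 1 (D + 1), (4 / 3 : ℝ) ^ k ≤ T₀ * ((D : ℝ) * (4 / 3 : ℝ) ^ D) := mul_le_mul_of_nonneg_left s₄ hT₀
  have m₃ : T₀ * ((D : ℝ) * (4 / 3 : ℝ) ^ D) ≤ ((D : ℝ) * (4 / 3 : ℝ) ^ D * T₀ / LB) * shellLaw π S H t 1 x := by
    rw [div_mul_eq_mul_div, le_div_iff₀ hLB0]
    have := mul_le_mul_of_nonneg_left hLB (by positivity : 0 ≤ (D : ℝ) * (4 / 3 : ℝ) ^ D * T₀)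
    linarith
  calc ∑ k ∈ Ico 1 (D + 1), (((2 * k).choose k : ℕ) : ℝ) / (4 : ℝ) ^ k *
        |(fwdDiff (1 : ℕ))^[k] (fun j => shellLaw π S H t (2 * j + 1) x) 0|
      ≤ ∑ k ∈ Ico 1 (D + 1), (Γ₀ * q₀ ^ k * shellLaw π S H t 1 x + (4 / 3 : ℝ) ^ k * T₀) := sum_le_sum hR₀
    _ = _ := e
    _ ≤ Γ₀ * shellLaw π S H t 1 x * (2 * q₀) + ((D : ℝ) * (4 / 3 : ℝ) ^ D * T₀ / LB) * shellLaw π S H t 1 x :=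
        add_le_add m₁ (m₂.trans m₃)
    _ = (2 * Γ₀ * q₀ + (D : ℝ) * (4 / 3 : ℝ) ^ D * T₀ / LB) * shellLaw π S H t 1 x := by ring


end Summit.PneNP.PneNP.Theorems.ChebyshevTracialDesignGammaDirectionFirstMomentBudget

end
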